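import Mathlib
import HarnessLib
import Summits.MatrixMultiplication.MatrixMultiplication.Theorems.FarEdgeDescentWidthTransform
import Summits.MatrixMultiplication.MatrixMultiplication.Theorems.FarEdgeDescentFloorDial
import Summits.MatrixMultiplication.MatrixMultiplication.Theorems.FarEdgeDescentFixedPointWedge
import Summits.MatrixMultiplication.MatrixMultiplication.Theorems.FarEdgeDescentPinnedSchedules
import Summits.MatrixMultiplication.MatrixMultiplication.Theorems.FarEdgeDescentPotentialCap
import Summits.MatrixMultiplication.MatrixMultiplication.Theorems.FarEdgeDescentChainCapSteps

/-!
# Far-edge descent, kernel XLII-C — the single-scale narrowness potential: XL-D reduced to a region criterion (model level)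

Kernel XLII-B (`FarEdgeDescentPotentialCap`) reduced the schedule cap XL-D to ONE potential with a
leaf bound, a global bound and a pair criterion at admissible nodes; kernel XLII-A
(`…FixedPointWedge`, `…FixedPointPinning`, `…PinnedSchedules`) proved that every admissible schedule
lives in the PINNED REGION: with `λ` the share, `V(z)` the narrowness and `d = 1 − (2β−1)λ`,
`β(−d) ≤ (β−1)V(z)` (wedge) and `|d| ≤ V(z)²` (pinning), for `3/2 ≤ β ≤ 2`, `z ≥ 9/10`.

THIS FILE instantiates the potential of memo g62 §3,
`Φ_{z,ε}(s) = share(s)·(ε + 1 − V_z(s))`  (`narrowPot`),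
whose base value is `ε·share` (bases have `V = 1`) and which is at most `(1+ε)/β`, and proves
(`capXLD_of_regionCriterion`): for `3/2 ≤ β ≤ 2`, `9/10 ≤ z ≤ 1`, `0 < ε`, `0 ≤ κ`, IF
(i) `RegionCriterion β z ε Vmin κ` — the pair inequality
`(1−(β−1)λ')·λ(ε+1−V)·x^κ + (1−(β−1)λ)·λ'(ε+1−V')·(1−x)^κ ≤ λ_P·(ε+1−V_P)` for all `x ∈ [0,1]` and
all share/narrowness data `(λ,V), (λ',V')` in the pinned region with `V, V' ∈ [Vmin, 1]`, `V_P` given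
by the exact product rule of XL-A and `V_P ≥ Vmin` — and
(ii) `FloorTransfer a β z Vmin` — every admissible schedule has `V_z ≥ Vmin` —
THEN the conclusion of XL-D holds for the dial `(a, β)` at exponent `κ`, with the explicit constant
`C = R(1+ε)/(β·ε·(log β)^κ)`.  Also: `profile_coeff` (profiles have nonnegative coefficients and no
constant term, so `V_z ≤ 1`, `narrow_le_one`).
STATUS OF THE HYPOTHESES (memo g62 §3, honest): (i) is CERTIFIED NUMERICALLY ONLY (adversarial
multistart on the region, `z = 24/25`, `ε = 1/50`, `κ = κ_S = log(4/3)/log 2`,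
`Vmin = Vmin_exact(β, z)`: worst ratio `0.983 … 0.99994` for `β ∈ {1.5, 1.55, …, 1.995}`; it FAILS at
`β = 1.999` by `3·10⁻⁶` and tends to equality in the neutral limit `λ' → 0`); (ii) with the exact
floor minimum `Vmin_exact(β,z) = Σ_{e≥1}(τ_e − τ_{e+1}) z^{e−1}`, `τ_j = min(1, β/(2 − 2^{−j}))`, is an
Abel summation over the floors `FloorOK` of XLI-A, typed but not yet proved (g63); the single-floor
transfer `narrowness_floor` of XL-A gives a weaker `Vmin`, for which (i) is numerically false at
`β = 1.9`.  So this file is a REDUCTION, not a proof of XL-D.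

HONEST FRAMING: MODEL level; no `sorry`, no new axioms; definitions `narrowPot`, `RegionCriterion`,
`FloorTransfer` only.  Nothing here touches `_root_.MatrixMultiplication` or the `closes` cut.
References: Schönhage 1981 [Schonhage1981]; Coppersmith–Winograd [CoppersmithWinograd1990]; kernels
XL-A/D, XLI-A, XLII-A/B; memo g62.
-/

noncomputable section

set_option linter.dupNamespace false

namespace Summit.MatrixMultiplication.MatrixMultiplication.Theorems.FarEdgeDescentNarrownessPotential

open Polynomial Finset
open Summit.MatrixMultiplication.MatrixMultiplication.Theorems.FarEdgeDescentWidthTransform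
open Summit.MatrixMultiplication.MatrixMultiplication.Theorems.FarEdgeDescentFloorDial
open Summit.MatrixMultiplication.MatrixMultiplication.Theorems.FarEdgeDescentFloorDial.Sched
open Summit.MatrixMultiplication.MatrixMultiplication.Theorems.FarEdgeDescentFixedPointWedge
open Summit.MatrixMultiplication.MatrixMultiplication.Theorems.FarEdgeDescentPinnedSchedules
open Summit.MatrixMultiplication.MatrixMultiplication.Theorems.FarEdgeDescentPotentialCap
open Summit.MatrixMultiplication.MatrixMultiplication.Theorems.FarEdgeDescentChainCapSteps

/-! ## Profiles have nonnegative coefficients and no constant term; `V_z ≤ 1` -/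

/-- Every admissible profile has nonnegative coefficients and vanishing constant term. -/
theorem profile_coeff {a β : ℝ} (hβ : 1 ≤ β) :
    ∀ s : Sched, Admissible a β s → (∀ e, 0 ≤ (profile β s).coeff e) ∧ (profile β s).coeff 0 = 0
  | base b, _ => by
      refine ⟨fun e => ?_, ?_⟩
      · rw [profile_base, coeff_X]; split_ifs <;> norm_num
      · rw [profile_base, coeff_X_zero]
  | node s t, h => by
      obtain ⟨hs, hs0⟩ := profile_coeff hβ s h.1
      obtain ⟨ht, ht0⟩ := profile_coeff hβ t h.2.1
      have hQs : 0 ≤ anchor β s := (anchor_legMass hβ s h.1).1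
      have hQt : 0 ≤ anchor β t := (anchor_legMass hβ t h.2.1).1
      rw [(qp_node β s t).2]
      refine ⟨fun e => ?_, ?_⟩
      · rw [coeff_add, coeff_add, coeff_C_mul, coeff_C_mul, coeff_mul]
        have h3 : 0 ≤ ∑ x ∈ antidiagonal e, (profile β s).coeff x.1 * (profile β t).coeff x.2 :=
          sum_nonneg fun x _ => mul_nonneg (hs x.1) (ht x.2)
        have h1 : 0 ≤ anchor β s * (profile β t).coeff e := mul_nonneg hQs (ht e)
        have h2 : 0 ≤ anchor β t * (profile β s).coeff e := mul_nonneg hQt (hs e)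
        linarith
      · rw [coeff_add, coeff_add, coeff_C_mul, coeff_C_mul, mul_coeff_zero, hs0, ht0]; ring

/-- Narrowness is at most one: `V_z(s) ≤ 1` for admissible `s`, `0 < z ≤ 1`, `1 ≤ β`. -/
theorem narrow_le_one {a β z : ℝ} (hβ : 1 ≤ β) (hz0 : 0 < z) (hz1 : z ≤ 1) (s : Sched)
    (hs : Admissible a β s) : narrow β z s ≤ 1 := by
  obtain ⟨hnn, h0⟩ := profile_coeff hβ s hs
  have hL : 0 < legMass β s := (anchor_legMass hβ s hs).2
  have hle := narrowness_le_one (profile β s) hnn h0 hz0.le hz1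
  unfold narrow
  rw [div_le_one (by positivity)]
  -- legMass = (profile).eval 1
  show (profile β s).eval z ≤ z * (profile β s).eval 1
  exact hle

/-! ## The potential and the two hypotheses -/

/-- The single-scale narrowness potential `Φ_{z,ε}(s) = share(s)·(ε + 1 − V_z(s))`. -/
def narrowPot (β z ε : ℝ) (s : Sched) : ℝ := share β s * (ε + 1 - narrow β z s)

/-- **The region criterion** (memo g62 §3): the pair inequality of the cap argument, at exponent `κ`,
for the potential `λ(ε+1−V)`, over all share/narrowness data of two factors in the PINNED REGION —
shares `0 < λ ≤ 1/β`, narrowness `V ∈ [Vmin, 1]`, the wedge `β((2β−1)λ−1) ≤ (β−1)V` and the pinning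
`|1−(2β−1)λ| ≤ V²` — whose product (exact rule of XL-A) has narrowness `V_P ≥ Vmin`. -/
def RegionCriterion (β z ε Vmin κ : ℝ) : Prop :=
  ∀ lam lam' V V' VP : ℝ,
    0 < lam → β * lam ≤ 1 → 0 < lam' → β * lam' ≤ 1 →
    Vmin ≤ V → V ≤ 1 → Vmin ≤ V' → V' ≤ 1 →
    β * ((2 * β - 1) * lam - 1) ≤ (β - 1) * V → β * ((2 * β - 1) * lam' - 1) ≤ (β - 1) * V' →
    |1 - (2 * β - 1) * lam| ≤ V ^ 2 → |1 - (2 * β - 1) * lam'| ≤ V' ^ 2 →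
    VP * (lam + lam' - (2 * β - 1) * lam * lam') =
      lam' * (1 - β * lam) * V' + lam * (1 - β * lam') * V + z * lam * lam' * V * V' →
    Vmin ≤ VP →
    ∀ x : ℝ, 0 ≤ x → x ≤ 1 →
      (1 - (β - 1) * lam') * (lam * (ε + 1 - V)) * x ^ κ +
          (1 - (β - 1) * lam) * (lam' * (ε + 1 - V')) * (1 - x) ^ κ ≤
        (lam + lam' - (2 * β - 1) * lam * lam') * (ε + 1 - VP)

/-- **Floor transfer** at level `Vmin`: every admissible schedule of the dial `(a, β)` has
narrowness `V_z ≥ Vmin` (for the exact floor minimum this is an Abel summation over `FloorOK`). -/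
def FloorTransfer (a β z Vmin : ℝ) : Prop :=
  ∀ s : Sched, Admissible a β s → Vmin ≤ narrow β z s

/-! ## The reduction -/

/-- The product rule of narrowness in share coordinates, for admissible factors. -/
theorem narrow_node_share {a β z : ℝ} (hβ : 1 ≤ β) (hz : z ≠ 0) {s t : Sched}
    (hs : Admissible a β s) (ht : Admissible a β t) :
    narrow β z (node s t) * (share β s + share β t - (2 * β - 1) * share β s * share β t) =
      share β t * (1 - β * share β s) * narrow β z t +
        share β s * (1 - β * share β t) * narrow β z s +
        z * share β s * share β t * narrow β z s * narrow β z t := by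
  obtain ⟨hQs, hLs⟩ := anchor_legMass hβ s hs
  obtain ⟨hQt, hLt⟩ := anchor_legMass hβ t ht
  have hβ0 : 0 < β := by linarith
  have hrs : 0 < anchor β s + β * legMass β s := by positivity
  have hrt : 0 < anchor β t + β * legMass β t := by positivity
  have hLP : 0 < legMass β (node s t) := by rw [legMass_node]; positivity
  have hmul := narrow_node_mul hz hLs.ne' hLt.ne' hLP.ne'
  obtain ⟨hQc, hLc⟩ := share_coords hrs.ne'
  obtain ⟨hQc', hLc'⟩ := share_coords hrt.ne'
  exact narrowness_product_share (β := β) (z := z) (V := narrow β z s) (V' := narrow β z t)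
    (VP := narrow β z (node s t)) hrs.ne' hrt.ne' hQc hLc hQc' hLc' hmul

set_option maxHeartbeats 400000 in
/-- **XL-D from the region criterion and the floor transfer.**  For `3/2 ≤ β ≤ 2`, `9/10 ≤ z ≤ 1`,
`0 < ε`, `0 ≤ κ`: `RegionCriterion β z ε Vmin κ` and `FloorTransfer a β z Vmin` imply, for every
`R ≥ 0` and base deviations `0 ≤ y₀ b ≤ R/(b+β)`, the cap
`dev β y₀ s ≤ R(1+ε)/(β ε (log β)^κ) · logSize β s ^ κ` on every admissible schedule. -/
theorem capXLD_of_regionCriterion {a β z ε Vmin κ : ℝ} (hβ : 3 / 2 ≤ β) (hβ2 : β ≤ 2)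
    (hz : 9 / 10 ≤ z) (hz1 : z ≤ 1) (hε : 0 < ε) (hκ : 0 ≤ κ)
    (hcrit : RegionCriterion β z ε Vmin κ) (hfloor : FloorTransfer a β z Vmin)
    {R : ℝ} (hR : 0 ≤ R) (y₀ : ℝ → ℝ) (hy : ∀ b : ℝ, 0 ≤ b → 0 ≤ y₀ b ∧ y₀ b ≤ R / (b + β)) :
    ∀ s : Sched, Admissible a β s →
      dev β y₀ s ≤ R * ((1 + ε) / β) / (ε * Real.log β ^ κ) * logSize β s ^ κ := by
  have hβ1 : 1 < β := by linarith
  have hβ0 : 0 < β := by linarith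
  have hz0 : z ≠ 0 := by intro h; rw [h] at hz; norm_num at hz
  have hzpos : 0 < z := by linarith
  -- (i) base value: Φ(base b) = ε·share
  have hbase : ∀ b : ℝ, 0 ≤ b → ε * share β (base b) ≤ narrowPot β z ε (base b) := by
    intro b _
    unfold narrowPot
    rw [narrow_base hz0]
    linarith
  -- (ii) global bound Φ ≤ (1+ε)/β
  have hM : ∀ s : Sched, Admissible a β s → narrowPot β z ε s ≤ (1 + ε) / β := by
    intro s hs
    obtain ⟨hl0, hl1, -⟩ := share_range hβ1.le s hs
    have hV0 : 0 ≤ narrow β z s :=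
      (pinning hβ hβ2 hz s (basesNonneg_of_admissible s hs)).2.2.1
    unfold narrowPot
    rw [le_div_iff₀ hβ0]
    nlinarith [mul_nonneg hl0.le hV0]
  -- (iii) the pair criterion at admissible nodes, from the region criterion
  have hpair : ∀ s t : Sched, Admissible a β (node s t) → ∀ x : ℝ, 0 ≤ x → x ≤ 1 →
      (1 - (β - 1) * share β t) * narrowPot β z ε s * x ^ κ +
          (1 - (β - 1) * share β s) * narrowPot β z ε t * (1 - x) ^ κ ≤
        narrowPot β z ε (node s t) := by
    intro s t h x hx0 hx1
    obtain ⟨hs, ht, _⟩ := h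
    obtain ⟨hls0, hls1, -⟩ := share_range hβ1.le s hs
    obtain ⟨hlt0, hlt1, -⟩ := share_range hβ1.le t ht
    obtain ⟨hQs, hLs, _, hWs, hPs⟩ := pinning hβ hβ2 hz s (basesNonneg_of_admissible s hs)
    obtain ⟨hQt, hLt, _, hWt, hPt⟩ := pinning hβ hβ2 hz t (basesNonneg_of_admissible t ht)
    have hVs1 := narrow_le_one hβ1.le hzpos hz1 s hs
    have hVt1 := narrow_le_one hβ1.le hzpos hz1 t ht
    have hfs := hfloor s hs
    have hft := hfloor t ht
    have hfP := hfloor (node s t) ⟨hs, ht, ‹_›⟩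
    have hprod := narrow_node_share hβ1.le hz0 hs ht
    have hrs : anchor β s + β * legMass β s ≠ 0 := by positivity
    have hrt : anchor β t + β * legMass β t ≠ 0 := by positivity
    -- wedge and pinning in share form
    have hWs' : β * ((2 * β - 1) * share β s - 1) ≤ (β - 1) * narrow β z s := by
      have e : β * (-(dfix β s)) = β * ((2 * β - 1) * share β s - 1) := by unfold dfix; ring
      linarith [hWs, e]
    have hWt' : β * ((2 * β - 1) * share β t - 1) ≤ (β - 1) * narrow β z t := by
      have e : β * (-(dfix β t)) = β * ((2 * β - 1) * share β t - 1) := by unfold dfix; ring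
      linarith [hWt, e]
    have hC := hcrit (share β s) (share β t) (narrow β z s) (narrow β z t) (narrow β z (node s t))
      hls0 hls1 hlt0 hlt1 hfs hVs1 hft hVt1 hWs' hWt' hPs hPt hprod hfP x hx0 hx1
    unfold narrowPot
    rw [share_node hrs hrt]
    exact hC
  -- assemble with kernel XLII-B
  have := cap_of_potential (a := a) hβ1 hκ hR hε y₀ hy (narrowPot β z ε) hbase hM hpair
  intro s hs
  have h := this s hs
  calc dev β y₀ s ≤ R * ((1 + ε) / β) / (ε * Real.log β ^ κ) * logSize β s ^ κ := h

/-- **XL-D for a dial from the two hypotheses**, in the literal shape of the conjecture's conclusion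
(exponent `κ_S = log(4/3)/log 2`). -/
theorem capXLD_of_regionCriterion' {a β z ε Vmin : ℝ} (hβ : 3 / 2 ≤ β) (hβ2 : β ≤ 2)
    (hz : 9 / 10 ≤ z) (hz1 : z ≤ 1) (hε : 0 < ε)
    (hcrit : RegionCriterion β z ε Vmin (Real.log (4 / 3) / Real.log 2))
    (hfloor : FloorTransfer a β z Vmin) :
    ∀ R : ℝ, 0 ≤ R → ∀ y₀ : ℝ → ℝ, (∀ b : ℝ, 0 ≤ b → 0 ≤ y₀ b ∧ y₀ b ≤ R / (b + β)) →
      ∃ C : ℝ, ∀ s : Sched, Admissible a β s →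
        dev β y₀ s ≤ C * logSize β s ^ (Real.log (4 / 3) / Real.log 2) := by
  intro R hR y₀ hy
  exact ⟨_, capXLD_of_regionCriterion hβ hβ2 hz hz1 hε kappaS_nonneg hcrit hfloor hR y₀ hy⟩

end Summit.MatrixMultiplication.MatrixMultiplication.Theorems.FarEdgeDescentNarrownessPotential
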